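import Literature.NumberTheory.EllipticCurves.ModularCurveManinSemistableBridgeProofs
import HarnessLib

/-!
# The Eichler–Shimura construction: `eichlerShimuraConstruction` is equivalent to its lattice
# form, and — granted modularity — to the congruence relation for `ℂ/Λ_f`

Topic `NumberTheory/EllipticCurves`; a proofs-only companion (theorems only: no definitions, no
named facts, nothing restated; D-0026) of `EichlerShimuraConstruction.lean`, written by the seat
of its named fact `Literature.NumberTheory.EllipticCurves.ModularForms.eichlerShimuraConstruction`
(Knapp 1993, Thm. 11.74 with Thm. 12.8; Agashe–Ribet–Stein 2006, §2): *a newform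
`f ∈ S₂(Γ₀(N))` with integer coefficients has an elliptic curve `W/ℚ` with `aₙ(W) = aₙ(f)` for all
`n`, and `c Λ_f ⊆ Λ_W` (`c ∈ ℤ ∖ {0}`) for every Néron-type period lattice `Λ_W` of `W`.*

State of the tree. `EichlerShimuraConstructionReductionProofs`, `…KernelProofs` (this seat) and
`PeriodLatticeRationalityUnconditionalProofs` reduced the fact, granted modularity
(`exists_isNewformOf`, used only for Carayol's part "`aₙ` for *all* `n`"), to the **congruence
relation** `hC` for the one explicit curve `E_f : y² = x³ + a₄x + a₆`,
`(-4a₄, -4a₆) = (g₂(Λ_f), g₃(Λ_f)) ∈ ℚ²` (the `ℚ`-model of `ℂ/Λ_f`, which exists unconditionally: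
`IsNewform0.exists_shortModel_periodLattice`, Knapp Thm. 11.74 (d), Cremona §2.14):
`a_p(f) = a_p(E_f)` for `p ∤ N` (`eichlerShimuraConstruction_of_congruenceRelation`). The converse
— that the fact *implies* the congruence relation for `E_f`, so that nothing cheaper can discharge
it — needed "commensurable Néron lattices ⇒ `ℚ`-isogenous", which the tree has meanwhile proved
(`isIsogenous_of_forall_mul_mem_lattice`, `AnalyticIsogenyDescentProofs`; Silverman AEC
Thm. VI.4.1 (b) / VI.5.3 with descent to `ℚ`). This file closes the circle:

* `isNewformOf_of_lattice_eq_periodLattice_of_eichlerShimuraConstruction` — granted the fact,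
  **every elliptic `W₀/ℚ` with a Néron-type period lattice equal to `Λ_f` has newform `f`**:
  the curve `W` of the fact satisfies `c Λ_f ⊆ Λ_W`, so `W₀ ~_ℚ W`
  (`isIsogenous_of_forall_mul_mem_lattice`) and isogenous curves have the same newform
  (`IsNewformOf.of_isIsogenous`, Faltings 1983 §5 / Knapp Thm. 11.67, a theorem of the tree).
  In particular `isNewformOf_shortModel_of_eichlerShimuraConstruction`:
  **`aₙ(E_f) = aₙ(f)` for all `n`** —
  Knapp's Thm. 11.74 (e) with Thm. 12.8 *for the curve `ℂ/Λ_f` itself* (Knapp, PDF p. 302: the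
  construction "uses the full image of cycles … as the set of periods", i.e. produces the strong
  Weil curve, whose lattice is `Λ_f` up to the rational Manin constant, Agashe–Ribet–Stein §2).
* `latticeEq_of_eichlerShimuraConstruction`, `eichlerShimuraConstruction_iff_latticeEq` — **the
  named fact is equivalent, unconditionally, to its lattice form** `LES` (an elliptic `W₀/ℚ` with
  `aₙ(W₀) = aₙ(f)` and a Néron-type period pair spanning *exactly* `Λ_f`), the hypothesis `hES` of
  `ModularCurveManinSemistableProofs` / `…KernelProofs` / `…BridgeProofs`
  (`⇐` is that file's `eichlerShimuraConstruction_of_latticeEq`).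
* `congruenceRelation_of_eichlerShimuraConstruction` — **the fact implies the congruence relation
  `a_p(f) = a_p(E_f)`** (at every `p`, indeed `aₙ` for every `n`); hence, granted modularity,
  `eichlerShimuraConstruction_iff_congruenceRelation` (**`hES ↔ hC`**),
  `eichlerShimuraConstruction_iff_rational_invariants` (`↔` the curve-free kernel `H` of
  `…KernelProofs`) and `eichlerShimuraConstruction_iff_strongWeil` (`↔` Knapp 11.74 (d)–(e) with
  `Λ_L = c • Λ_f`, `c ∈ ℚˣ`).
* `eichlerShimuraConstruction_of_congruenceRelation_cofinite`,
  `eichlerShimuraConstruction_iff_congruenceRelation_cofinite` — **Shimura's form suffices**: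
  granted modularity, the fact already follows from (and so is equivalent to) the congruence
  relation for `E_f` at *all but finitely many* primes (Shimura 1971, Thm. 7.15: the zeta
  function of the quotient "coincides, up to a finite number of Euler factors, with" `L(s, f)` —
  the form Eichler's and Shimura's proofs give before Igusa), by strong multiplicity one
  (`isNewformOf_of_cuspCoeff_prime_eq`: `a_p(f) = a_p(W)` off a finite set and modularity of `W`
  give `aₙ(f) = aₙ(W)` for all `n`).
* `level_eq_conductorNorm_shortModel_of_eichlerShimuraConstruction` — granted the fact and
  modularity, **`N` is the conductor of `E_f`** (Carayol's Thm. 12.8 for `ℂ/Λ_f`, here from strong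
  multiplicity one with levels, `IsNewform0.level_eq_of_heckeEigenvalue_eq_holds`).
* `exists_weierstrassCurve_of_rational_isNewform0_of_congruenceRelation` — level by level, the
  tree's weak form `exists_weierstrassCurve_of_rational_isNewform0` (`NewformGaloisRep.lean`;
  Shimura Thm. 7.14/7.15, Knapp 11.74 (e)) follows from the congruence relation for `E_f` at that
  level alone (its curve can be taken to be `E_f`).

Upshot for the ledger: the open content of `eichlerShimuraConstruction` beyond
`exists_isNewformOf` is *exactly* the Eichler–Shimura congruence relation for `E_f = ℂ/Λ_f`,
cofinitely in `p` — neither more (this file, `⇒`) nor less (`⇐`); its printed proofs (Eichler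
1954; Shimura 1971, §7.2–7.5; Knapp §XI.11 with Igusa 1959; Diamond–Shurman §8.7) reduce `X₀(N)`
and the Hecke correspondence `T_p` modulo `p`, a theory the tree does not have. Nothing is
discharged here; no statement of the tree is changed; no definition and no named fact is added.

## References

* A. W. Knapp, *Elliptic Curves*, Math. Notes 40, Princeton 1993: Thm. 11.67 (PDF p. 281),
  Thm. 11.74 with Remarks (PDF p. 287), Thm. 12.8 (PDF p. 301), Prop. 12.9 and PDF p. 302,
  Notes to §XI.11 (PDF p. 312). [Knapp1993]
* G. Shimura, *Introduction to the arithmetic theory of automorphic functions*, Princeton 1971: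
  Thm. 7.14, Thm. 7.15 (PDF p. 212). [ShimuraIATAF1971]
* A. Agashe, K. Ribet, W. Stein, *The Manin constant*, Pure Appl. Math. Q. 2 (2006), §2 (p. 618).
  [AgasheRibetStein2006]
* J. E. Cremona, *Algorithms for modular elliptic curves*, 2nd ed., CUP 1997: §2.14 (pp. 33–34).
  [CremonaAlgorithms1997]
* J. H. Silverman, *The Arithmetic of Elliptic Curves*, 2nd ed., GTM 106 (2009): Thm. VI.4.1,
  Thm. VI.5.3. [SilvermanAEC2009]
* C. Breuil, B. Conrad, F. Diamond, R. Taylor, *On the modularity of elliptic curves over `ℚ`*,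
  J. Amer. Math. Soc. 14 (2001), Thm. A and p. 845, "(2) ⇒ (6)". [BCDTJAMS2001]
-/

noncomputable section

open scoped MatrixGroups ModularForm Pointwise

open CongruenceSubgroup UpperHalfPlane ModularFormClass

namespace Literature.NumberTheory.EllipticCurves.ModularForms

/-! ### Granted the fact, every `ℚ`-model of `ℂ/Λ_f` has newform `f` -/

/-- **Granted `eichlerShimuraConstruction`, an elliptic `W₀/ℚ` whose Néron-type period lattice is
`Λ_f` has newform `f`** (`aₙ(W₀) = aₙ(f)` for all `n`). The curve `W` of the fact has newform `f`
and `c Λ_f ⊆ Λ_W` for its Néron-type lattice `Λ_W` (`exists_isNeronLatticeOf_holds`, Silverman AEC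
VI.5.1), `c ∈ ℤ ∖ {0}`; so `z ↦ cz : ℂ/Λ_f → ℂ/Λ_W` is an isogeny `W₀ → W` defined over `ℚ`
(`isIsogenous_of_forall_mul_mem_lattice`, AEC Thm. VI.4.1 (b) / VI.5.3 with descent), and
`ℚ`-isogenous curves have the same newform (`IsNewformOf.of_isIsogenous`, Knapp Thm. 11.67).
[cite: Knapp1993, Thm. 11.74 (e) with Remarks (PDF p. 287), Thm. 11.67 (PDF p. 281)]
[cite: SilvermanAEC2009, Thm. VI.4.1, Thm. VI.5.3] -/
theorem isNewformOf_of_lattice_eq_periodLattice_of_eichlerShimuraConstruction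
    (hES : eichlerShimuraConstruction) {N : ℕ} [NeZero N] {f : CuspForm (Gamma0 N) 2}
    (hf : IsNewform0 f) (hint : ∀ n : ℕ, ∃ a : ℤ, cuspCoeff f n = a)
    {W₀ : WeierstrassCurve ℚ} [W₀.IsElliptic] {L₀ : PeriodPair}
    (hL₀ : IsNeronLatticeOf (W₀.baseChange ℂ) L₀)
    (hΛ : L₀.lattice.toAddSubgroup = periodLattice f) : IsNewformOf W₀ f := by
  obtain ⟨W, hW, hfW, hlat⟩ := hES hf hint
  haveI := hW
  haveI : (W.baseChange ℂ).IsElliptic := by rw [WeierstrassCurve.baseChange]; infer_instance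
  obtain ⟨L, hL⟩ := exists_isNeronLatticeOf_holds (W.baseChange ℂ)
  obtain ⟨c, hc, hcle⟩ := hlat hL
  have hle : ∀ z ∈ L₀.lattice, ((c : ℚ) : ℂ) * z ∈ L.lattice := fun z hz ↦ by
    rw [Rat.cast_intCast]
    refine hcle z ?_
    rw [← hΛ]
    exact hz
  exact hfW.of_isIsogenous
    (isIsogenous_of_forall_mul_mem_lattice hL₀.1 hL₀.2 hL.1 hL.2 (c := (c : ℚ))
      (by exact_mod_cast hc) hle)

/-- **Knapp's Thm. 11.74 (e) with Thm. 12.8 for `ℂ/Λ_f` itself, granted the fact**: for a newform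
`f ∈ S₂(Γ₀(N))` with `K_f = ℚ`, a period pair `L` spanning `Λ_f` and `a₄, a₆ ∈ ℚ` with
`g₂(L) = -4a₄`, `g₃(L) = -4a₆` (they exist:
`IsNewform0.exists_rat_g₂_g₃_of_lattice_eq_periodLattice`), the curve
`E_f : y² = x³ + a₄x + a₆` over `ℚ` — elliptic, with Néron-type period pair `L`
(`isElliptic_shortModel`, `isNeronLatticeOf_shortModel`) — has newform `f`: `aₙ(E_f) = aₙ(f)` for
all `n`. (Knapp, PDF p. 302: the Eichler–Shimura construction "uses the full image of cycles of
`X₀(N)` as the set of periods", so its curve is `ℂ/Λ_f` up to the rational Manin constant,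
Agashe–Ribet–Stein §2; Cremona §2.14: "`E_f = ℂ/Λ_f` … is the modular elliptic curve attached to
`f`".)
[cite: Knapp1993, Thm. 11.74 (d)(e) with Remarks (PDF p. 287), Thm. 12.8 (PDF p. 301), p. 302]
[cite: AgasheRibetStein2006, §2 (p. 618)] [cite: CremonaAlgorithms1997, §2.14 (pp. 33–34)] -/
theorem isNewformOf_shortModel_of_eichlerShimuraConstruction (hES : eichlerShimuraConstruction)
    {N : ℕ} [NeZero N] {f : CuspForm (Gamma0 N) 2} (hf : IsNewform0 f) (hQ : coeffField f = ⊥)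
    {L : PeriodPair} (hL : L.lattice.toAddSubgroup = periodLattice f) {a₄ a₆ : ℚ}
    (h₂ : L.g₂ = -4 * (a₄ : ℂ)) (h₃ : L.g₃ = -4 * (a₆ : ℂ)) :
    IsNewformOf ({ a₁ := 0, a₂ := 0, a₃ := 0, a₄ := a₄, a₆ := a₆ } : WeierstrassCurve ℚ) f :=
  haveI := isElliptic_shortModel h₂ h₃
  isNewformOf_of_lattice_eq_periodLattice_of_eichlerShimuraConstruction hES hf
    (hf.exists_intCast_eq_cuspCoeff hQ) (isNeronLatticeOf_shortModel h₂ h₃) hL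

/-- **Granted the fact and modularity, `N` is the conductor of `E_f = ℂ/Λ_f`** (Carayol 1986;
Knapp Thm. 12.8: "`N` coincides with the conductor of `E`"), here by strong multiplicity one with
levels: `aₙ(E_f) = aₙ(f)` for all `n` (`isNewformOf_shortModel_of_eichlerShimuraConstruction`) and
the newform of `E_f` at level `cond(E_f)` given by modularity is then `f`
(`isNewformOf_of_cuspCoeff_prime_eq`). [cite: Knapp1993, Thm. 12.8 (PDF p. 301)] -/
theorem level_eq_conductorNorm_shortModel_of_eichlerShimuraConstruction (h₁ : exists_isNewformOf)
    (hES : eichlerShimuraConstruction) {N : ℕ} [NeZero N] {f : CuspForm (Gamma0 N) 2}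
    (hf : IsNewform0 f) (hQ : coeffField f = ⊥) {L : PeriodPair}
    (hL : L.lattice.toAddSubgroup = periodLattice f) {a₄ a₆ : ℚ} (h₂ : L.g₂ = -4 * (a₄ : ℂ))
    (h₃ : L.g₃ = -4 * (a₆ : ℂ)) :
    N = ({ a₁ := 0, a₂ := 0, a₃ := 0, a₄ := a₄, a₆ := a₆ } : WeierstrassCurve ℚ).conductorNorm
      ℤ := by
  haveI := isElliptic_shortModel h₂ h₃
  exact (isNewformOf_of_cuspCoeff_prime_eq h₁ hf
    ({ a₁ := 0, a₂ := 0, a₃ := 0, a₄ := a₄, a₆ := a₆ } : WeierstrassCurve ℚ) Set.finite_empty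
    fun p _ _ ↦ (isNewformOf_shortModel_of_eichlerShimuraConstruction hES hf hQ hL h₂ h₃).2 p).2

/-! ### The fact is equivalent to its lattice form, unconditionally -/

/-- **The lattice form of the Eichler–Shimura construction from the tree's form**: granted
`eichlerShimuraConstruction`, every newform `f ∈ S₂(Γ₀(N))` with integer coefficients has an
elliptic `W₀/ℚ` with `aₙ(W₀) = aₙ(f)` for all `n` and a Néron-type period pair `L₀` spanning
*exactly* `Λ_f` — namely `W₀ = E_f`, the `ℚ`-model of `ℂ/Λ_f`
(`IsNewform0.exists_shortModel_periodLattice`, unconditional), which has newform `f` by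
`isNewformOf_of_lattice_eq_periodLattice_of_eichlerShimuraConstruction`. This is the hypothesis
`hES` of `ModularCurveManinSemistableProofs` (Knapp Thm. 11.74 (c)–(e), Thm. 12.8, Prop. 12.9 (a)).
[cite: Knapp1993, Thm. 11.74 (c)–(e) with Remarks (PDF p. 287), Thm. 12.8 (PDF p. 301)]
[cite: Knapp1993, Prop. 12.9 (a) and PDF p. 302] -/
theorem latticeEq_of_eichlerShimuraConstruction (hES : eichlerShimuraConstruction)
    {N : ℕ} [NeZero N] {f : CuspForm (Gamma0 N) 2} (hf : IsNewform0 f)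
    (hint : ∀ n : ℕ, ∃ a : ℤ, cuspCoeff f n = a) :
    ∃ (W₀ : WeierstrassCurve ℚ) (_ : W₀.IsElliptic), IsNewformOf W₀ f ∧
      ∃ L₀ : PeriodPair, IsNeronLatticeOf (W₀.baseChange ℂ) L₀ ∧
        (L₀.lattice : Set ℂ) = periodLattice f := by
  obtain ⟨Lf, a₄, a₆, hLf, hE, hNer⟩ :=
    hf.exists_shortModel_periodLattice (coeffField_eq_bot_of_forall_exists_intCast hint)
  haveI := hE
  exact ⟨_, hE, isNewformOf_of_lattice_eq_periodLattice_of_eichlerShimuraConstruction hES hf hint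
    hNer hLf, Lf, hNer, by rw [← hLf, Submodule.coe_toAddSubgroup]⟩

/-- **`eichlerShimuraConstruction` is equivalent to its lattice form, with no hypothesis**:
`⇒` is `latticeEq_of_eichlerShimuraConstruction`, `⇐` is `eichlerShimuraConstruction_of_latticeEq`
(`ModularCurveManinSemistableProofs`: all Néron-type period pairs of `W₀` span `Λ_f`, so `c = 1`).
So the inclusion `c Λ_f ⊆ Λ_W` of the vendored statement carries no less content than the printed
"`E` is isomorphic to `ℂ/Λ_f`" (Knapp Thm. 11.74 (d)) for the strong Weil curve.
[cite: Knapp1993, Thm. 11.74 (c)–(e) with Remarks (PDF p. 287), Thm. 12.8 (PDF p. 301), p. 302]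
-/
theorem eichlerShimuraConstruction_iff_latticeEq :
    eichlerShimuraConstruction ↔
      ∀ {N : ℕ} [NeZero N] {f : CuspForm (Gamma0 N) 2}, IsNewform0 f →
        (∀ n : ℕ, ∃ a : ℤ, cuspCoeff f n = a) →
        ∃ (W₀ : WeierstrassCurve ℚ) (_ : W₀.IsElliptic), IsNewformOf W₀ f ∧
          ∃ L₀ : PeriodPair, IsNeronLatticeOf (W₀.baseChange ℂ) L₀ ∧
            (L₀.lattice : Set ℂ) = periodLattice f :=
  ⟨fun hES ↦ @fun _ _ _ hf hint ↦ latticeEq_of_eichlerShimuraConstruction hES hf hint,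
    fun h ↦ eichlerShimuraConstruction_of_latticeEq h⟩

/-! ### The fact implies the congruence relation for `E_f`; equivalence granted modularity -/

/-- **The Eichler–Shimura congruence relation for `E_f`, from the fact**: for a newform `f` with
`K_f = ℚ`, a period pair `L` spanning `Λ_f` and `a₄, a₆ ∈ ℚ` with `(g₂(L), g₃(L)) = (-4a₄, -4a₆)`,
`a_p(f) = a_p(y² = x³ + a₄x + a₆)` — at every `p` (Knapp Thm. 11.74 (e): "except possibly for"
`p ∣ N`; with the Remark on Igusa and Thm. 12.8, everywhere), by
`isNewformOf_shortModel_of_eichlerShimuraConstruction`. Stated with the argument order of the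
hypothesis `hC` of `PeriodLatticeRationalityUnconditionalProofs`.
[cite: Knapp1993, Thm. 11.74 (e) with Remarks (PDF p. 287), Thm. 12.8 (PDF p. 301)] -/
theorem congruenceRelation_of_eichlerShimuraConstruction (hES : eichlerShimuraConstruction)
    (N : ℕ) [NeZero N] (f : CuspForm (Gamma0 N) 2) (hf : IsNewform0 f) (hQ : coeffField f = ⊥)
    (L : PeriodPair) (hL : L.lattice.toAddSubgroup = periodLattice f) (a₄ a₆ : ℚ)
    (h₂ : L.g₂ = -4 * (a₄ : ℂ)) (h₃ : L.g₃ = -4 * (a₆ : ℂ)) (p : ℕ) :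
    (qExpansion 1 ⇑f).coeff p =
      (({ a₁ := 0, a₂ := 0, a₃ := 0, a₄ := a₄, a₆ := a₆ } : WeierstrassCurve ℚ).LFunction p : ℂ) :=
  (isNewformOf_shortModel_of_eichlerShimuraConstruction hES hf hQ hL h₂ h₃).2 p

/-- **`eichlerShimuraConstruction ↔` the congruence relation for `E_f`, granted modularity**
(`exists_isNewformOf`, Breuil–Conrad–Diamond–Taylor 2001, Thm. A — used only in `⇐`, for Carayol's
part "`aₙ` for all `n`"): `⇒` is `congruenceRelation_of_eichlerShimuraConstruction`, `⇐` is the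
tree's `eichlerShimuraConstruction_of_congruenceRelation`. So the open content of the named fact
beyond modularity is *exactly* `a_p(f) = a_p(ℂ/Λ_f)` for `p ∤ N`.
[cite: Knapp1993, Thm. 11.74 (e) with Remarks (PDF p. 287), Thm. 12.8 (PDF p. 301)]
[cite: BCDTJAMS2001, p. 845, "(2) ⇒ (6)"] -/
theorem eichlerShimuraConstruction_iff_congruenceRelation (h₁ : exists_isNewformOf) :
    eichlerShimuraConstruction ↔
      ∀ (N : ℕ) [NeZero N] (f : CuspForm (Gamma0 N) 2), IsNewform0 f → coeffField f = ⊥ →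
        ∀ (L : PeriodPair), L.lattice.toAddSubgroup = periodLattice f →
          ∀ a₄ a₆ : ℚ, L.g₂ = -4 * (a₄ : ℂ) → L.g₃ = -4 * (a₆ : ℂ) →
            ∀ p : ℕ, p.Prime → ¬ p ∣ N →
              (qExpansion 1 ⇑f).coeff p =
                (({ a₁ := 0, a₂ := 0, a₃ := 0, a₄ := a₄, a₆ := a₆ } : WeierstrassCurve ℚ).LFunction
                  p : ℂ) :=
  ⟨fun hES N _ f hf hQ L hL a₄ a₆ h₂ h₃ p _ _ ↦
      congruenceRelation_of_eichlerShimuraConstruction hES N f hf hQ L hL a₄ a₆ h₂ h₃ p,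
    eichlerShimuraConstruction_of_congruenceRelation h₁⟩

/-- **`eichlerShimuraConstruction` from modularity and the *cofinite* congruence relation**
(Shimura 1971, Thm. 7.15, for the model `y² = x³ + a₄x + a₆` of `ℂ/Λ_f`: `a_p(f) = a_p(E_f)` for
all but finitely many primes `p`). Proof: for a newform `f` with integer coefficients, `K_f = ℚ`
(`coeffField_eq_bot_of_forall_exists_intCast`), a period pair `L_f` spans `Λ_f`
(`IsNewform0.exists_periodPair_of_coeffField_eq_bot`, Shimura Thm. 7.14) and `a₄, a₆ ∈ ℚ` exist
(`IsNewform0.exists_rat_g₂_g₃_of_lattice_eq_periodLattice`); `E_f` is elliptic with Néron-type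
pair `L_f`; `a_p(f) = a_p(E_f)` off a finite set and the modularity of `E_f` give
`aₙ(f) = aₙ(E_f)` for all `n` by strong multiplicity one (`isNewformOf_of_cuspCoeff_prime_eq`);
and `1 · Λ_f ⊆ Λ` for every Néron-type period pair of `E_f` (`IsNeronLatticeOf.lattice_eq`).
[cite: ShimuraIATAF1971, Thm. 7.14 and Thm. 7.15 (PDF p. 212)]
[cite: Knapp1993, Thm. 11.74 with Remarks (PDF p. 287) and Thm. 12.8 (PDF p. 301)] -/
theorem eichlerShimuraConstruction_of_congruenceRelation_cofinite (h₁ : exists_isNewformOf)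
    (hC : ∀ (N : ℕ) [NeZero N] (f : CuspForm (Gamma0 N) 2), IsNewform0 f → coeffField f = ⊥ →
      ∀ (L : PeriodPair), L.lattice.toAddSubgroup = periodLattice f →
        ∀ a₄ a₆ : ℚ, L.g₂ = -4 * (a₄ : ℂ) → L.g₃ = -4 * (a₆ : ℂ) →
          {p : ℕ | p.Prime ∧ (qExpansion 1 ⇑f).coeff p ≠
            (({ a₁ := 0, a₂ := 0, a₃ := 0, a₄ := a₄, a₆ := a₆ } : WeierstrassCurve ℚ).LFunction
              p : ℂ)}.Finite) :
    eichlerShimuraConstruction := by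
  intro N _ f hf hint
  have hQ : coeffField f = ⊥ := coeffField_eq_bot_of_forall_exists_intCast hint
  obtain ⟨Lf, hLf⟩ := hf.exists_periodPair_of_coeffField_eq_bot hQ
  obtain ⟨a₄, a₆, h₂, h₃⟩ := hf.exists_rat_g₂_g₃_of_lattice_eq_periodLattice hQ Lf hLf
  haveI := isElliptic_shortModel h₂ h₃
  have hW : IsNewformOf
      ({ a₁ := 0, a₂ := 0, a₃ := 0, a₄ := a₄, a₆ := a₆ } : WeierstrassCurve ℚ) f :=
    (isNewformOf_of_cuspCoeff_prime_eq h₁ hf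
      ({ a₁ := 0, a₂ := 0, a₃ := 0, a₄ := a₄, a₆ := a₆ } : WeierstrassCurve ℚ)
      (hC N f hf hQ Lf hLf a₄ a₆ h₂ h₃)
      fun p hp hpS ↦ not_not.mp fun hne ↦ hpS ⟨hp, hne⟩).1
  refine ⟨_, ‹_›, hW, fun {L} hL ↦ ⟨1, one_ne_zero, fun z hz ↦ ?_⟩⟩
  rw [Int.cast_one, one_mul, hL.lattice_eq (isNeronLatticeOf_shortModel h₂ h₃)]
  rw [← hLf] at hz
  exact hz

/-- **`eichlerShimuraConstruction ↔` the cofinite congruence relation for `E_f`, granted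
modularity**: `⇒` by `congruenceRelation_of_eichlerShimuraConstruction` (the exceptional set is
empty), `⇐` is `eichlerShimuraConstruction_of_congruenceRelation_cofinite`. So, granted
`exists_isNewformOf`, a discharge of the named fact must supply exactly Shimura's Thm. 7.15 for
`ℂ/Λ_f`, and supplies no less. [cite: ShimuraIATAF1971, Thm. 7.15 (PDF p. 212)]
[cite: Knapp1993, Thm. 11.74 (e) with Remarks (PDF p. 287), Thm. 12.8 (PDF p. 301)] -/
theorem eichlerShimuraConstruction_iff_congruenceRelation_cofinite (h₁ : exists_isNewformOf) :
    eichlerShimuraConstruction ↔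
      ∀ (N : ℕ) [NeZero N] (f : CuspForm (Gamma0 N) 2), IsNewform0 f → coeffField f = ⊥ →
        ∀ (L : PeriodPair), L.lattice.toAddSubgroup = periodLattice f →
          ∀ a₄ a₆ : ℚ, L.g₂ = -4 * (a₄ : ℂ) → L.g₃ = -4 * (a₆ : ℂ) →
            {p : ℕ | p.Prime ∧ (qExpansion 1 ⇑f).coeff p ≠
              (({ a₁ := 0, a₂ := 0, a₃ := 0, a₄ := a₄, a₆ := a₆ } : WeierstrassCurve ℚ).LFunction
                p : ℂ)}.Finite :=
  ⟨fun hES N _ f hf hQ L hL a₄ a₆ h₂ h₃ ↦ Set.finite_empty.subset fun p hp ↦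
      (hp.2 (congruenceRelation_of_eichlerShimuraConstruction hES N f hf hQ L hL a₄ a₆ h₂ h₃
        p)).elim,
    eichlerShimuraConstruction_of_congruenceRelation_cofinite h₁⟩

/-! ### Equivalence with the curve-free kernel `H` and the strong Weil statement `SW` -/

/-- **The curve-free kernel `H` of `EichlerShimuraConstructionKernelProofs` from the fact**: for a
newform `f` with `K_f = ℚ` and a period pair `L` spanning `Λ_f`, `g₂(L) = -4a₄`, `g₃(L) = -4a₆`
with `a₄, a₆ ∈ ℚ` (unconditional, `IsNewform0.exists_rat_g₂_g₃_of_lattice_eq_periodLattice`) and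
`a_p(f) = a_p(y² = x³ + a₄x + a₆)` for `p ∤ N` (`congruenceRelation_of_eichlerShimuraConstruction`).
[cite: Knapp1993, Thm. 11.74 (d)(e) with Remarks (PDF p. 287)]
[cite: CremonaAlgorithms1997, §2.14 (pp. 33–34)] -/
theorem rational_invariants_of_eichlerShimuraConstruction (hES : eichlerShimuraConstruction)
    (N : ℕ) [NeZero N] (f : CuspForm (Gamma0 N) 2) (hf : IsNewform0 f) (hQ : coeffField f = ⊥)
    (L : PeriodPair) (hL : L.lattice.toAddSubgroup = periodLattice f) :
    ∃ a₄ a₆ : ℚ, L.g₂ = -4 * (a₄ : ℂ) ∧ L.g₃ = -4 * (a₆ : ℂ) ∧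
      ∀ p : ℕ, p.Prime → ¬ p ∣ N →
        (qExpansion 1 ⇑f).coeff p =
          (({ a₁ := 0, a₂ := 0, a₃ := 0, a₄ := a₄, a₆ := a₆ } : WeierstrassCurve ℚ).LFunction p
            : ℂ) := by
  obtain ⟨a₄, a₆, h₂, h₃⟩ := hf.exists_rat_g₂_g₃_of_lattice_eq_periodLattice hQ L hL
  exact ⟨a₄, a₆, h₂, h₃, fun p _ _ ↦
    congruenceRelation_of_eichlerShimuraConstruction hES N f hf hQ L hL a₄ a₆ h₂ h₃ p⟩

/-- **`eichlerShimuraConstruction ↔ H`, granted modularity**: with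
`eichlerShimuraConstruction_of_rational_invariants` (`EichlerShimuraConstructionKernelProofs`).
[cite: Knapp1993, Thm. 11.74 (d)(e) with Remarks (PDF p. 287), Thm. 12.8 (PDF p. 301)]
[cite: CremonaAlgorithms1997, §2.14 (pp. 33–34)] -/
theorem eichlerShimuraConstruction_iff_rational_invariants (h₁ : exists_isNewformOf) :
    eichlerShimuraConstruction ↔
      ∀ (N : ℕ) [NeZero N] (f : CuspForm (Gamma0 N) 2), IsNewform0 f → coeffField f = ⊥ →
        ∀ (L : PeriodPair), L.lattice.toAddSubgroup = periodLattice f →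
          ∃ a₄ a₆ : ℚ, L.g₂ = -4 * (a₄ : ℂ) ∧ L.g₃ = -4 * (a₆ : ℂ) ∧
            ∀ p : ℕ, p.Prime → ¬ p ∣ N →
              (qExpansion 1 ⇑f).coeff p =
                (({ a₁ := 0, a₂ := 0, a₃ := 0, a₄ := a₄, a₆ := a₆ } : WeierstrassCurve ℚ).LFunction
                  p : ℂ) :=
  ⟨fun hES N _ f hf hQ L hL ↦ rational_invariants_of_eichlerShimuraConstruction hES N f hf hQ L hL,
    eichlerShimuraConstruction_of_rational_invariants h₁⟩

/-- **Knapp's Thm. 11.74 (d)–(e) with the rational Manin constant (`SW`), from the fact**: for a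
newform `f` with `K_f = ℚ`, an elliptic `W/ℚ` with `a_p(W) = a_p(f)` for `p ∤ N` and a Néron-type
period pair `L` of `W` with `Λ_L = c • Λ_f`, `c ∈ ℚˣ` — here `W = E_f`, `c = 1`
(`latticeEq_of_eichlerShimuraConstruction`).
[cite: Knapp1993, Thm. 11.74 (d)(e) with Remarks (PDF p. 287) and PDF p. 302]
[cite: AgasheRibetStein2006, §2 (p. 618)] -/
theorem strongWeil_of_eichlerShimuraConstruction (hES : eichlerShimuraConstruction)
    (N : ℕ) [NeZero N] (f : CuspForm (Gamma0 N) 2) (hf : IsNewform0 f) (hQ : coeffField f = ⊥) :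
    ∃ W : WeierstrassCurve ℚ, W.IsElliptic ∧
      (∀ p : ℕ, p.Prime → ¬ p ∣ N → (qExpansion 1 ⇑f).coeff p = (W.LFunction p : ℂ)) ∧
        ∃ (L : PeriodPair) (c : ℚ), IsNeronLatticeOf (W.baseChange ℂ) L ∧ c ≠ 0 ∧
          (L.lattice : Set ℂ) = (c : ℂ) • (periodLattice f : Set ℂ) := by
  obtain ⟨W₀, hW₀, hf₀, L₀, hL₀, hΛ⟩ :=
    latticeEq_of_eichlerShimuraConstruction hES hf (hf.exists_intCast_eq_cuspCoeff hQ)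
  exact ⟨W₀, hW₀, fun p _ _ ↦ hf₀.2 p, L₀, 1, hL₀, one_ne_zero,
    by rw [Rat.cast_one, one_smul, hΛ]⟩

/-- **`eichlerShimuraConstruction ↔ SW`, granted modularity**: `⇒` is
`strongWeil_of_eichlerShimuraConstruction`; `⇐` by `rational_invariants_iff_strongWeil` and
`eichlerShimuraConstruction_of_rational_invariants` (`EichlerShimuraConstructionKernelProofs`).
[cite: Knapp1993, Thm. 11.74 (d)(e) with Remarks (PDF p. 287), Thm. 12.8 (PDF p. 301), p. 302]
[cite: AgasheRibetStein2006, §2 (p. 618)] -/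
theorem eichlerShimuraConstruction_iff_strongWeil (h₁ : exists_isNewformOf) :
    eichlerShimuraConstruction ↔
      ∀ (N : ℕ) [NeZero N] (f : CuspForm (Gamma0 N) 2), IsNewform0 f → coeffField f = ⊥ →
        ∃ W : WeierstrassCurve ℚ, W.IsElliptic ∧
          (∀ p : ℕ, p.Prime → ¬ p ∣ N → (qExpansion 1 ⇑f).coeff p = (W.LFunction p : ℂ)) ∧
            ∃ (L : PeriodPair) (c : ℚ), IsNeronLatticeOf (W.baseChange ℂ) L ∧ c ≠ 0 ∧
              (L.lattice : Set ℂ) = (c : ℂ) • (periodLattice f : Set ℂ) :=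
  ⟨fun hES N _ f hf hQ ↦ strongWeil_of_eichlerShimuraConstruction hES N f hf hQ,
    fun hSW ↦ eichlerShimuraConstruction_of_rational_invariants h₁
      (rational_invariants_iff_strongWeil.mpr hSW)⟩

/-! ### The weak form `exists_weierstrassCurve_of_rational_isNewform0`, level by level -/

/-- **The tree's weak Eichler–Shimura fact at level `N` from the congruence relation for `E_f` at
level `N`**: `exists_weierstrassCurve_of_rational_isNewform0` (`NewformGaloisRep.lean`: an
elliptic `W/ℚ` with `a_p(W) = a_p(f)` for `p ∤ N`; Shimura 1971, Thm. 7.14/7.15, Knapp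
Thm. 11.74 (e)) with `W := E_f`, the `ℚ`-model `y² = x³ + a₄x + a₆` of `ℂ/Λ_f`
(`IsNewform0.exists_periodPair_of_coeffField_eq_bot`,
`IsNewform0.exists_rat_g₂_g₃_of_lattice_eq_periodLattice`, `isElliptic_shortModel`, all
unconditional). So that fact, too, has exactly the congruence relation as its open content.
[cite: Knapp1993, Thm. 11.74 (d)(e) with Remarks (PDF p. 287)]
[cite: ShimuraIATAF1971, Thm. 7.14 and Thm. 7.15 (PDF p. 212)] -/
theorem exists_weierstrassCurve_of_rational_isNewform0_of_congruenceRelation {N : ℕ} [NeZero N]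
    (hC : ∀ (f : CuspForm (Gamma0 N) 2), IsNewform0 f → coeffField f = ⊥ →
      ∀ (L : PeriodPair), L.lattice.toAddSubgroup = periodLattice f →
        ∀ a₄ a₆ : ℚ, L.g₂ = -4 * (a₄ : ℂ) → L.g₃ = -4 * (a₆ : ℂ) →
          ∀ p : ℕ, p.Prime → ¬ p ∣ N →
            (qExpansion 1 ⇑f).coeff p =
              (({ a₁ := 0, a₂ := 0, a₃ := 0, a₄ := a₄, a₆ := a₆ } : WeierstrassCurve ℚ).LFunction
                p : ℂ)) :
    exists_weierstrassCurve_of_rational_isNewform0 (N := N) := by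
  intro f hf hQ
  obtain ⟨Lf, hLf⟩ := hf.exists_periodPair_of_coeffField_eq_bot hQ
  obtain ⟨a₄, a₆, h₂, h₃⟩ := hf.exists_rat_g₂_g₃_of_lattice_eq_periodLattice hQ Lf hLf
  exact ⟨_, isElliptic_shortModel h₂ h₃, hC f hf hQ Lf hLf a₄ a₆ h₂ h₃⟩

end Literature.NumberTheory.EllipticCurves.ModularForms

end
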